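import Mathlib.LinearAlgebra.ExteriorPower.Basis
import Literature.NumberTheory.GaloisCohomology.PBasisDerivation
import Literature.NumberTheory.GaloisCohomology.KaehlerBasisOfDerivations
import HarnessLib

/-!
# The Kähler differentials of a ring with a finite `p`-basis are free on the `dt_i`

For a ring `R` of characteristic `p` with a finite `p`-basis `t : ι → R` (`IsPBasis p t`), the absolute
Kähler differentials `Ω[R⁄ℤ]` form a free `R`-module with basis `(d t_i)_i` (`IsPBasis.kaehlerBasis`), the
coordinates of `dx` being the partial derivatives `∂_i x` of `PBasisDerivation.lean`
(`kaehlerBasis_repr_D`, `D_eq_sum_pderiv_smul`); consequently `Ωⁿ_R = ⋀ⁿ Ω[R⁄ℤ]` is free on the increasing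
products `dt_s = dt_{s₁} ∧ ⋯ ∧ dt_{sₙ}`, `s ⊆ ι` of size `n` (`IsPBasis.formBasis`, Mathlib's
`Module.Basis.exteriorPower`).  This is Matsumura's "a `p`-basis is a differential basis" (Thm. 26.5,
there for fields) for rings, obtained from the generic criterion of `KaehlerBasisOfDerivations.lean`:
the `∂_i` are dual to the `t_j`, and the `d t_i` span because `d(c^p) = 0` and `d(t^α)` is a combination
of the `d t_i`.

## References

* H. Matsumura, *Commutative Ring Theory*, CUP, §26, Thm. 26.5. [Matsumura1987]
-/

noncomputable section

open scoped BigOperators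
open KaehlerDifferential (D)

namespace Literature.NumberTheory.GaloisCohomology

universe u v

variable {p : ℕ} [hp : Fact p.Prime] {R : Type u} [CommRing R] [CharP R p] {ι : Type v} [Fintype ι]

namespace IsPBasis

variable {t : ι → R}

/-! ### Spanning -/

/-- **The `d t_i` span `Ω[R⁄ℤ]`** when `t` is a `p`-basis: `d x = ∑_α c_α^p d(t^α)` (`d (c^p) = 0`) and each
`d(t^α)` is an `R`-combination of the `d t_i`. [cite: Matsumura1987, Thm. 26.5] -/
theorem span_range_D_eq_top [DecidableEq ι] (h : IsPBasis p t) :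
    Submodule.span R (Set.range fun i => D ℤ R (t i)) = ⊤ :=
  span_range_D_eq_top_of_forall_mem t fun x => by
    induction x using h.induction_on with
    | monomial α => exact D_prod_pow_mem_span t fun j => (α j : ℕ)
    | add x y hx hy => rw [map_add]; exact Submodule.add_mem _ hx hy
    | pow_mul c x hx =>
      rw [Derivation.leibniz, D_pow_char, smul_zero, add_zero]
      exact Submodule.smul_mem _ _ hx
    | zero => rw [map_zero]; exact Submodule.zero_mem _

/-! ### The Kähler basis -/

/-- **The `R`-basis `(d t_i)_i` of `Ω[R⁄ℤ]`** attached to a finite `p`-basis `t` (dual system: the partial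
derivatives `∂_i`). [cite: Matsumura1987, Thm. 26.5] -/
def kaehlerBasis [DecidableEq ι] (h : IsPBasis p t) : Module.Basis ι R (Ω[R⁄ℤ]) :=
  basisKaehlerOfDerivations t h.pderiv h.pderiv_apply_eq_ite h.span_range_D_eq_top

/-- The basis vectors are the `d t_i`. [folklore] -/
@[simp] theorem kaehlerBasis_apply [DecidableEq ι] (h : IsPBasis p t) (i : ι) :
    h.kaehlerBasis i = D ℤ R (t i) :=
  basisKaehlerOfDerivations_apply t _ _ _ i

/-- The basis vectors are the `d t_i` (as a function). [folklore] -/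
theorem coe_kaehlerBasis [DecidableEq ι] (h : IsPBasis p t) : ⇑h.kaehlerBasis = fun i => D ℤ R (t i) :=
  funext h.kaehlerBasis_apply

/-- Coordinates in the Kähler basis are the lifted partial derivatives. [folklore] -/
theorem kaehlerBasis_repr_apply [DecidableEq ι] (h : IsPBasis p t) (ω : Ω[R⁄ℤ]) (i : ι) :
    h.kaehlerBasis.repr ω i = (h.pderiv i).liftKaehlerDifferential ω :=
  basisKaehlerOfDerivations_repr_apply t _ _ _ ω i

/-- **The `i`-th coordinate of `dx` is `∂_i x`.** [cite: Matsumura1987, Thm. 26.5] -/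
@[simp] theorem kaehlerBasis_repr_D [DecidableEq ι] (h : IsPBasis p t) (x : R) (i : ι) :
    h.kaehlerBasis.repr (D ℤ R x) i = h.pderiv i x :=
  basisKaehlerOfDerivations_repr_D t _ _ _ x i

/-- **`dx = ∑ i, ∂_i x • d t_i`.** [cite: Matsumura1987, Thm. 26.5] -/
theorem D_eq_sum_pderiv_smul [DecidableEq ι] (h : IsPBasis p t) (x : R) :
    D ℤ R x = ∑ i, h.pderiv i x • D ℤ R (t i) :=
  (sum_apply_smul_D_eq t h.pderiv h.pderiv_apply_eq_ite h.span_range_D_eq_top x).symm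

/-- `d(t^α) = ∑ i, (α_i * t^(α - e_i)) • d t_i`. [folklore] -/
theorem D_pMonomial [DecidableEq ι] (h : IsPBasis p t) (α : ι → Fin p) :
    D ℤ R (pMonomial p t α) = ∑ i, (((α i : ℕ) : R) * pMonomial p t (α - Pi.single i 1)) • D ℤ R (t i) := by
  rw [h.D_eq_sum_pderiv_smul]
  exact Finset.sum_congr rfl fun i _ => by rw [h.pderiv_pMonomial]

/-! ### The basis of `n`-forms -/

/-- **The `R`-basis of `Ωⁿ_R = ⋀ⁿ Ω[R⁄ℤ]`** by the increasing products `dt_s = dt_{s₁} ∧ ⋯ ∧ dt_{sₙ}` over the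
`n`-element subsets `s` of the (linearly ordered) index type. [folklore] -/
def formBasis [LinearOrder ι] (h : IsPBasis p t) (n : ℕ) :
    Module.Basis (Set.powersetCard ι n) R (⋀[R]^n (Ω[R⁄ℤ])) :=
  h.kaehlerBasis.exteriorPower n

/-- The basis vectors of `formBasis` are the `ιMulti_family` of the `d t_i`. [folklore] -/
theorem formBasis_apply [LinearOrder ι] (h : IsPBasis p t) (n : ℕ) (s : Set.powersetCard ι n) :
    h.formBasis n s = exteriorPower.ιMulti_family R n (fun i => D ℤ R (t i)) s := by
  rw [formBasis, exteriorPower.basis_apply, coe_kaehlerBasis]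

/-- The basis vectors of `formBasis`, coerced into the exterior algebra. [folklore] -/
theorem coe_formBasis_apply [LinearOrder ι] (h : IsPBasis p t) (n : ℕ) (s : Set.powersetCard ι n) :
    (h.formBasis n s : ExteriorAlgebra R (Ω[R⁄ℤ])) =
      ExteriorAlgebra.ιMulti_family R n (fun i => D ℤ R (t i)) s := by
  rw [formBasis_apply, exteriorPower.ιMulti_family_apply_coe]

end IsPBasis

end Literature.NumberTheory.GaloisCohomology

end
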